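import Summits.ABC.IUTFork.Cor312SoundInput
import Summits.ABC.IUTFork.Cor312StatementBridgeChecks
import HarnessLib

/-!
# [IUTchIII] Cor. 3.12 — kernel probes of the gap statement of record `SoundAtInput` (second-reader audit)

Record-only file (D-0012) of the abc-iut cell (wave-5 prover abc-iut-w5-d193, RQ7 second pass WITH KERNEL PROBE
of abc-iut-c312-9's `Cor312SoundInput.lean`, p413249; cf. `HOME/plan/ADJUDICATION-SPEC.md` §2 (G1)/(G1′)/(G2)/(G3));
TAKES NO SIDE. `SoundAtInput P G` (GapA of record) says: for EVERY object `o` of `†𝒞^⊩_lgp`, the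
procession-normalized hull volume `negLogThetaAt P o` is finite and `≥` the `q`-side volume of `G.linkMap o`, for a
value-group gluing `G : LinkGluing P` (Team B). This file records, as kernel theorems over the FROZEN fields and
nothing else, WHERE the surplus of GapA over the printed `Statement` lives:

* §1 `trivialGluing` — the type `LinkGluing P` is inhabited for EVERY setting by the constant map `o ↦ q-pilot`
  (its only law `link_thetaPilot` holds by `rfl`); at it, GapA reads "every input's hull volume is finite and
  dominates `−|log(q)|`" (`soundAtInput_trivialGluing_iff`) — no across-the-link content. Consequence for (G2):
  the GAP row must say WHICH `G` (the frozen files pin `G` by `link_thetaPilot` only).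
* §2 OBJECT-BLIND COLLAPSE — every layer of `negLogThetaAt P o` depends on `o` only through the glue field
  `P.thetaRegionOf · o` (`negLogThetaAt_eq_of_thetaRegionOf_eq`); hence if the glue field does not distinguish
  inputs (`∀ m o, thetaRegionOf m o = thetaRegionOf m thetaPilot`), GapA at the trivial gluing is LITERALLY the
  printed Statement (`soundAtInput_trivialGluing_iff_statement_of_objectBlind`), and if both glue fields are
  object-blind it is the Statement at EVERY gluing (`soundAtInput_iff_statement_of_objectBlind`). Over the frozen
  `Cor312.Setting` nothing constrains `thetaRegionOf` at non-pilot objects; over the real constructor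
  `Setting.ofComparison` it is the binder `RealPieces.thetaBox m o`. So GapA is non-circular EXACTLY to the
  extent that (a) the Θ-side glue binder is specified at non-pilot inputs and (b) `G` is specified.
* §3 ORTHOGONAL-FALSITY WITNESS — a two-object variant `toySettingTwo` of c312-6's nonempty toy (pilot `true`
  with Kummer image everything; a second object `false` with EMPTY Kummer image; hull frame `neFrame` in which, as
  for the boxes `λ·𝒪` of the intended model — cf. the `HasHull` docstring of `Cor312.HullFrame` — the empty set
  admits no hull): `BridgeHyps` and the printed `Statement` HOLD, yet `SoundAtInput` FAILS for EVERY gluing `G`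
  (`not_soundAtInput_toySettingTwo`), because the finiteness conjunct is imposed at the non-pilot input. So, at
  the interface level, GapA is STRICTLY STRONGER than `BridgeHyps ∧ Statement`, and the surplus exhibited here
  is a finiteness clause at inputs other than the Θ-pilot — a clause with no counterpart in print's (xi-f)
  (whose "`−|log(Θ)| ∈ ℝ`" concerns the Θ-pilot; ADJUDICATION-SPEC §2 (G1′) STRONGER-THAN-PRINT caution).
* §4 The finiteness-guarded form still funnels (`statement_of_soundAtFiniteInputs`: `ThetaFinite` + "∀ o, hull
  volume finite → bound" ⟹ Statement) and survives the witness (`soundAtFiniteInputs_toySettingTwo`); it is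
  stated inline as a hypothesis shape — no new `Prop` definition (D-0067 (1)).

Nothing here asserts or denies Cor. 3.12, `SoundAtInput`, or anything about the intended model; every statement
is about the typed interfaces. typed ≠ proved; no side taken. [claim: Mochizuki2012, status: disputed]
-/

noncomputable section

namespace Summit.ABC.IUTFork.Cor312Vol

open Thm311 Cor312 Literature.IUT.LogThetaLattice

variable {T : ThetaIndex} {S : Situation T} (P : Cor312.Setting S)

/-! ## 1. The constant gluing inhabits `LinkGluing P` for every setting -/

/-- The CONSTANT value-group gluing `o ↦ q-pilot`: a term of Team B's `LinkGluing P` for every setting `P`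
(its one law `link_thetaPilot` is `rfl`). Witness that the type pins the gluing by its value at the Θ-pilot
only. [folklore] -/
def trivialGluing : LinkGluing P := ⟨fun _ => P.qPilot, rfl⟩

/-- Its object map is constant. [folklore] -/
theorem trivialGluing_linkMap (o : P.Ob P.sig.Clgp) : (trivialGluing P).linkMap o = P.qPilot := rfl

/-- GapA AT THE CONSTANT GLUING reads: every input's hull volume is finite and dominates `−|log(q)|` — a
statement in which the link does not occur. [folklore] -/
theorem soundAtInput_trivialGluing_iff :
    SoundAtInput P (trivialGluing P) ↔
      ∀ o : P.Ob P.sig.Clgp,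
        negLogThetaAt P o ≠ ⊤ ∧ ((P.negLogQ : ℝ) : WithTop ℝ) ≤ negLogThetaAt P o :=
  Iff.rfl

/-! ## 2. Object-blind glue collapses GapA to the printed Statement -/

/-- Every layer of the input-parameterized hull volume depends on the input `o` only through the glue field
`P.thetaRegionOf · o`: two inputs with the same Kummer images have the same `negLogThetaAt`. [folklore] -/
theorem negLogThetaAt_eq_of_thetaRegionOf_eq {o o' : P.Ob P.sig.Clgp}
    (h : ∀ m : ℤ, P.thetaRegionOf m o = P.thetaRegionOf m o') :
    negLogThetaAt P o = negLogThetaAt P o' := by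
  have h3 : ∀ (j : T.Label) (vQ : T.VQ), thetaRegion3At P o j vQ = thetaRegion3At P o' j vQ := by
    intro j vQ
    unfold thetaRegion3At
    exact Set.iUnion_congr fun m => by rw [h m]
  have hP : ∀ (j : T.Label) (vQ : T.VQ), possibleImagesAt P o j vQ = possibleImagesAt P o' j vQ := by
    intro j vQ
    unfold possibleImagesAt
    rw [h3 j vQ]
  have hL : ∀ (j : T.Label) (vQ : T.VQ), thetaLocalAt P o j vQ = thetaLocalAt P o' j vQ := by
    intro j vQ
    unfold thetaLocalAt HullDefinedAt thetaHullAt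
    rw [hP j vQ]
  have hF : ThetaFiniteAt P o ↔ ThetaFiniteAt P o' := by
    unfold ThetaFiniteAt
    simp only [hL]
  unfold negLogThetaAt
  by_cases hfo : ThetaFiniteAt P o
  · rw [if_pos hfo, if_pos (hF.mp hfo)]
    simp only [hL]
  · rw [if_neg hfo, if_neg fun h' => hfo (hF.mpr h')]

/-- If the Θ-side glue field does not distinguish inputs, every input has the Θ-pilot's global hull volume
`−|log(Θ)|`. [folklore] -/
theorem negLogThetaAt_eq_negLogTheta_of_objectBlind
    (hblind : ∀ (m : ℤ) (o : P.Ob P.sig.Clgp), P.thetaRegionOf m o = P.thetaRegionOf m P.thetaPilot)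
    (o : P.Ob P.sig.Clgp) : negLogThetaAt P o = P.negLogTheta := by
  rw [← negLogThetaAt_thetaPilot]
  exact negLogThetaAt_eq_of_thetaRegionOf_eq P fun m => hblind m o

/-- **OBJECT-BLIND COLLAPSE (Θ-side)**: if the glue field `thetaRegionOf` does not distinguish inputs, GapA at the
constant gluing IS the printed Statement. The frozen `Cor312.Setting` places no constraint on `thetaRegionOf` at
non-pilot objects (over `Setting.ofComparison` it is the binder `RealPieces.thetaBox`), so the non-circularity of
GapA is carried entirely by that binder's object-dependence and by the choice of gluing. [folklore] -/
theorem soundAtInput_trivialGluing_iff_statement_of_objectBlind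
    (hblind : ∀ (m : ℤ) (o : P.Ob P.sig.Clgp), P.thetaRegionOf m o = P.thetaRegionOf m P.thetaPilot) :
    SoundAtInput P (trivialGluing P) ↔ P.Statement := by
  refine ⟨statement_of_soundAtInput P _, fun hS o => ?_⟩
  rw [negLogThetaAt_eq_negLogTheta_of_objectBlind P hblind o]
  exact hS

/-- The `q`-side analogue: the input-parameterized `q`-volume depends on `o'` only through `P.qRegionOf o'`.
[folklore] -/
theorem negLogQAt_eq_of_qRegionOf_eq {o o' : P.ObΔ} (h : P.qRegionOf o = P.qRegionOf o') :
    negLogQAt P o = negLogQAt P o' := by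
  unfold negLogQAt qLocalAt
  rw [h]

/-- **OBJECT-BLIND COLLAPSE (both sides)**: if neither glue field distinguishes inputs, GapA is the printed
Statement at EVERY gluing `G`. [folklore] -/
theorem soundAtInput_iff_statement_of_objectBlind
    (hΘ : ∀ (m : ℤ) (o : P.Ob P.sig.Clgp), P.thetaRegionOf m o = P.thetaRegionOf m P.thetaPilot)
    (hq : ∀ o' : P.ObΔ, P.qRegionOf o' = P.qRegionOf P.qPilot) (G : LinkGluing P) :
    SoundAtInput P G ↔ P.Statement := by
  refine ⟨statement_of_soundAtInput P G, fun hS o => ?_⟩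
  rw [negLogThetaAt_eq_negLogTheta_of_objectBlind P hΘ o, negLogQAt_eq_of_qRegionOf_eq P (hq (G.linkMap o)),
    negLogQAt_qPilot]
  exact hS

/-! ## 3. A two-object toy: `BridgeHyps` and the Statement hold, GapA fails for every gluing -/

namespace SoundInputChecks

open Cor312.Checks Cor312Vol.Checks

/-- The hull frame whose only hull-set is everything, in which every subset is relatively compact and a subset
ADMITS A HULL iff it is NONEMPTY — the feature of the boxes `λ·𝒪` of the intended model recorded in the
`HasHull` docstring of `Cor312.HullFrame` (no least box contains `∅`). [folklore] -/
def neFrame (X : Type) : HullFrame X where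
  Hul := {Set.univ}
  IsBounded := fun _ => True
  HasHull := fun U => U.Nonempty
  hul_bounded := fun _ _ => trivial
  bounded_mono := fun _ _ _ _ => trivial
  exists_hul := fun _ _ => ⟨Set.univ, rfl, Set.subset_univ _⟩
  hull_mem := fun U _ _ => by
    have h1 : {H | H ∈ ({Set.univ} : Set (Set X)) ∧ U ⊆ H} = {Set.univ} := by
      ext H
      simp only [Set.mem_setOf_eq, Set.mem_singleton_iff]
      exact ⟨fun h => h.1, fun h => ⟨h, h ▸ Set.subset_univ _⟩⟩
    rw [h1, Set.sInter_singleton]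
    rfl

/-- In `neFrame` the hull of a subset is everything. [folklore] -/
theorem neFrame_hull (X : Type) (U : Set X) : (neFrame X).hull U = Set.univ := by
  unfold HullFrame.hull
  rw [if_pos (show (neFrame X).IsBounded U from trivial)]
  have h1 : {H | H ∈ (neFrame X).Hul ∧ U ⊆ H} = {Set.univ} := by
    ext H
    simp only [neFrame, Set.mem_setOf_eq, Set.mem_singleton_iff]
    exact ⟨fun h => h.1, fun h => ⟨h, h ▸ Set.subset_univ _⟩⟩
  rw [h1, Set.sInter_singleton]

/-- A TWO-OBJECT output of Prop. 3.7: every Frobenioid and strip is a point, every object type is `Bool`; the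
object-forming algorithm returns `true` (so the Θ-pilot object is `true`). [folklore] -/
def toySig2 : GlobalLGPFrobenioidSignature 2 Unit (· ∈ (Set.univ : Set Unit)) Unit (fun _ _ => Unit)
    (fun _ => Bool) id Unit (fun _ _ => Unit) (fun _ _ => Unit) where
  FMOD := fun _ => ()
  Fmod := fun _ => ()
  Ffrak := fun _ => ()
  isoModMOD := fun _ => ()
  isoModFrak := fun _ => ()
  isoFrakMOD := fun _ => ()
  CLGP := ()
  Clgp := ()
  FLGP := ()
  Flgp := ()
  Fgau := ()
  isoGauLGP := ()
  isoLGPlgp := ()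
  isoCLGPlgp := ()
  embLGP := fun b _ => b
  embLgp := fun b _ => b
  embLGP_injective := fun a b h => by simpa using congrFun h 0
  embLgp_injective := fun a b h => by simpa using congrFun h 0
  objOfLgp := fun _ => true
  objOfLGP := fun _ => true
  objOfFrak := fun _ _ => true
  objOfMOD := fun _ _ => true

/-- The TWO-OBJECT toy setting over c312-7's `toySituation 0` (all log-volumes of nonempty regions `0`): c312-6's
nonempty toy with objects `Bool`, the hull frame `neFrame`, Kummer image everything for the object `true` (the
Θ-pilot) and EMPTY for the object `false`, `q`-regions everything. [folklore] -/
def toySettingTwo : Setting (toySituation 0) where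
  n := 0
  HT := ℤ × ℤ
  LogLink := fun _ _ => Unit
  IsFull := fun _ => True
  lattice :=
    { theater := fun n m => (n, m)
      distinct := fun p q h => by simpa using h
      logLink := fun _ _ => ()
      logLink_full := fun _ _ => trivial }
  Frd := Unit
  IsoF := fun _ _ => Unit
  Ob := fun _ => Bool
  realify := id
  Strip := Unit
  IsoS := fun _ _ => Unit
  M := fun _ _ => Unit
  sig := toySig2
  split := { Msplit := fun _ _ => ⊤, exists_gen := fun _ _ => ⟨⟨(), trivial⟩, top_unit_isGenerator _⟩ }
  ObΔ := Unit
  N := fun _ _ => Unit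
  qData := { q := fun _ _ => (), q_gen := fun _ _ => unit_isGenerator _, objOf := fun _ => () }
  frame := fun _ _ => neFrame _
  hul_adm := fun _ _ _ _ => trivial
  thetaRegionOf := fun _ o _ _ => cond o Set.univ ∅
  qRegionOf := fun _ _ _ => Set.univ
  qRegion_mem := fun _ _ => rfl
  qSupport_finite := fun _ => Set.toFinite _

/-- The Θ-pilot object of the two-object toy is `true`. [folklore] -/
theorem toySettingTwo_thetaPilot : toySettingTwo.thetaPilot = true := rfl

/-- The Kummer images of the Θ-pilot are everything. [folklore] -/
theorem toySettingTwo_thetaRegion (m : ℤ) (j : toyIndex.Label) (vQ : toyIndex.VQ) :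
    toySettingTwo.thetaRegion m j vQ = Set.univ := rfl

/-- The (Ind3)-enlarged Θ-pilot region is everything. [folklore] -/
theorem toySettingTwo_thetaRegion3 (j : toyIndex.Label) (vQ : toyIndex.VQ) :
    toySettingTwo.thetaRegion3 j vQ = Set.univ := by
  apply Set.eq_univ_of_univ_subset
  exact Set.subset_iUnion (fun m : ℤ => toySettingTwo.thetaRegion m j vQ) 0

/-- Every possible image of the Θ-pilot is everything. [folklore] -/
theorem toySettingTwo_possibleImages {j : toyIndex.Label} {vQ : toyIndex.VQ}
    {U : Set ((toySituation 0).L.Packet j vQ)} (hU : U ∈ toySettingTwo.possibleImages j vQ) :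
    U = Set.univ := by
  obtain ⟨Φ, -, rfl⟩ := hU
  rw [toySettingTwo_thetaRegion3, Set.image_univ]
  exact Set.range_eq_univ.mpr (Φ j vQ).surjective

/-- The union of the possible images of the Θ-pilot is everything. [folklore] -/
theorem toySettingTwo_sUnion_possibleImages (j : toyIndex.Label) (vQ : toyIndex.VQ) :
    ⋃₀ toySettingTwo.possibleImages j vQ = Set.univ := by
  apply Set.eq_univ_of_univ_subset
  rw [← toySettingTwo_thetaRegion3 j vQ]
  exact Set.subset_sUnion_of_mem (toySettingTwo.thetaRegion3_mem_possibleImages j vQ)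

/-- The Θ-pilot's unions of possible images admit their hulls (they are nonempty). [folklore] -/
theorem toySettingTwo_hullDefined (j : toyIndex.Label) (vQ : toyIndex.VQ) : toySettingTwo.HullDefined j vQ := by
  refine ⟨trivial, ?_⟩
  show (⋃₀ toySettingTwo.possibleImages j vQ).Nonempty
  rw [toySettingTwo_sUnion_possibleImages]
  exact Set.univ_nonempty

/-- The local Θ-volume of the Θ-pilot is `0`. [folklore] -/
theorem toySettingTwo_thetaLocal (j : toyIndex.Label) (vQ : toyIndex.VQ) :
    toySettingTwo.thetaLocal j vQ = ((0 : ℝ) : WithTop ℝ) := by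
  unfold Setting.thetaLocal
  rw [if_pos (toySettingTwo_hullDefined j vQ)]
  have hh : toySettingTwo.thetaHull j vQ = Set.univ := neFrame_hull _ _
  rw [hh]
  exact congrArg _ (toyData_logvol_univ 0 j vQ)

/-- The two-object toy is `ThetaFinite`. [folklore] -/
theorem toySettingTwo_thetaFinite : toySettingTwo.ThetaFinite :=
  ⟨fun j vQ => by rw [toySettingTwo_thetaLocal (Setting.labelSucc j) vQ]; exact WithTop.coe_ne_top,
    fun _ => Set.toFinite _⟩

/-- `BridgeHyps` holds for the two-object toy (as for c312-6's nonempty toy: all log-volumes of `toyData 0` are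
`0`, everything admissible, finite index types, hull-set and Θ-regions everything). [folklore] -/
theorem bridgeHyps_toySettingTwo : BridgeHyps toySettingTwo where
  mono := fun i vQ A B _ _ _ => by
    show (toyData 0).logvol (Setting.labelSucc i) vQ A ≤ (toyData 0).logvol (Setting.labelSucc i) vQ B
    unfold toyData
    simp only
    split_ifs <;> exact le_rfl
  image_adm := fun _ _ _ _ => trivial
  image_fin := fun _ => Set.toFinite _
  hul_nonempty := fun _ _ H hH => by
    rw [show H = Set.univ from Set.mem_singleton_iff.mp hH]
    exact Set.univ_nonempty
  theta_nonempty := fun i vQ => by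
    rw [toySettingTwo_thetaRegion3 (Setting.labelSucc i) vQ]
    exact Set.univ_nonempty
  finite := toySettingTwo_thetaFinite

/-- The Kummer images of the two-object toy are admissible. [folklore] -/
theorem thetaRegionsAdm_toySettingTwo : ThetaRegionsAdm toySettingTwo := fun _ _ _ => trivial

/-- Volume transport holds in the two-object toy, uniformly at `m = 0` (both regions are everything). [folklore] -/
theorem volumeTransportAt_toySettingTwo : VolumeTransportAt toySettingTwo 0 := fun _ _ => le_rfl

/-- **The printed Statement HOLDS in the two-object toy** (through Team B's proved route). [folklore] -/
theorem toySettingTwo_statement : toySettingTwo.Statement :=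
  statement_of_volumeTransport toySettingTwo bridgeHyps_toySettingTwo thetaRegionsAdm_toySettingTwo
    (volumeTransport_of_at volumeTransportAt_toySettingTwo)

/-- The non-pilot object `false` has EMPTY (Ind3)-enlarged Kummer image. [folklore] -/
theorem toySettingTwo_thetaRegion3At_false (j : toyIndex.Label) (vQ : toyIndex.VQ) :
    thetaRegion3At toySettingTwo false j vQ = ∅ := by
  unfold thetaRegion3At
  exact Set.iUnion_eq_empty.mpr fun _ => rfl

/-- … so the union of its possible images is empty. [folklore] -/
theorem toySettingTwo_sUnion_possibleImagesAt_false (j : toyIndex.Label) (vQ : toyIndex.VQ) :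
    ⋃₀ possibleImagesAt toySettingTwo false j vQ = ∅ := by
  apply Set.sUnion_eq_empty.2
  rintro U ⟨Φ, -, rfl⟩
  rw [toySettingTwo_thetaRegion3At_false, Set.image_empty]

/-- … which admits no hull in `neFrame`: the local hull volume of the input `false` is `⊤`. [folklore] -/
theorem toySettingTwo_thetaLocalAt_false (j : toyIndex.Label) (vQ : toyIndex.VQ) :
    thetaLocalAt toySettingTwo false j vQ = ⊤ := by
  unfold thetaLocalAt
  rw [if_neg]
  rintro ⟨-, hne⟩
  change (⋃₀ possibleImagesAt toySettingTwo false j vQ).Nonempty at hne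
  rw [toySettingTwo_sUnion_possibleImagesAt_false] at hne
  exact Set.not_nonempty_empty hne

/-- … so the input `false` is not `ThetaFiniteAt`. [folklore] -/
theorem toySettingTwo_not_thetaFiniteAt_false : ¬ ThetaFiniteAt toySettingTwo false := fun h =>
  h.1 ⟨0, by decide⟩ () (toySettingTwo_thetaLocalAt_false _ _)

/-- … and its global hull volume is `⊤`. [folklore] -/
theorem toySettingTwo_negLogThetaAt_false : negLogThetaAt toySettingTwo false = ⊤ := by
  unfold negLogThetaAt
  rw [if_neg toySettingTwo_not_thetaFiniteAt_false]

/-- **GapA FAILS in the two-object toy for EVERY gluing** — at the non-pilot input `false`, by the finiteness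
conjunct alone. [folklore] -/
theorem not_soundAtInput_toySettingTwo (G : LinkGluing toySettingTwo) : ¬ SoundAtInput toySettingTwo G :=
  fun h => (h false).1 toySettingTwo_negLogThetaAt_false

/-- **INTERFACE-LEVEL SEPARATION**: there is a verbatim setting with all of c312-6's `BridgeHyps` and the printed
`Statement` in which GapA fails for every gluing. So `SoundAtInput` is strictly stronger than
`BridgeHyps ∧ Statement`; the surplus exhibited is the finiteness of hull volumes at a NON-PILOT input.
[folklore] -/
theorem soundAtInput_stronger_than_statement :
    ∃ (P : Cor312.Setting (toySituation 0)),
      BridgeHyps P ∧ P.Statement ∧ ∀ G : LinkGluing P, ¬ SoundAtInput P G :=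
  ⟨toySettingTwo, bridgeHyps_toySettingTwo, toySettingTwo_statement, not_soundAtInput_toySettingTwo⟩

end SoundInputChecks

/-! ## 4. The finiteness-guarded form still funnels to the Statement and survives the witness -/

/-- The FINITENESS-GUARDED soundness shape ("for every input whose hull volume is finite, the bound holds")
together with the Corollary's own finiteness clause `ThetaFinite` (a `BridgeHyps` field) implies the printed
Statement — same one-line evaluation at the Θ-pilot. Stated as a hypothesis shape; no new definition.
[folklore] -/
theorem statement_of_soundAtFiniteInputs (G : LinkGluing P) (hfin : P.ThetaFinite)
    (h : ∀ o : P.Ob P.sig.Clgp, negLogThetaAt P o ≠ ⊤ →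
      ((negLogQAt P (G.linkMap o) : ℝ) : WithTop ℝ) ≤ negLogThetaAt P o) :
    P.Statement := by
  have hne : negLogThetaAt P P.thetaPilot ≠ ⊤ := by
    rw [negLogThetaAt_thetaPilot]
    unfold Setting.negLogTheta
    rw [if_pos hfin]
    exact WithTop.coe_ne_top
  have hle := h P.thetaPilot hne
  rw [negLogThetaAt_thetaPilot] at hne hle
  rw [G.link_thetaPilot, negLogQAt_qPilot] at hle
  exact ⟨hne, hle⟩

/-- GapA implies the guarded shape (it is weaker). [folklore] -/
theorem soundAtFiniteInputs_of_soundAtInput (G : LinkGluing P) (h : SoundAtInput P G) :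
    ∀ o : P.Ob P.sig.Clgp, negLogThetaAt P o ≠ ⊤ →
      ((negLogQAt P (G.linkMap o) : ℝ) : WithTop ℝ) ≤ negLogThetaAt P o :=
  fun o _ => (h o).2

/-- The two-object toy SATISFIES the guarded shape at the constant gluing (at `true` both sides are `0`; at
`false` the guard fails), so the §3 witness separates GapA from its guarded form. [folklore] -/
theorem soundAtFiniteInputs_toySettingTwo :
    ∀ o : SoundInputChecks.toySettingTwo.Ob SoundInputChecks.toySettingTwo.sig.Clgp,
      negLogThetaAt SoundInputChecks.toySettingTwo o ≠ ⊤ →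
        ((negLogQAt SoundInputChecks.toySettingTwo
            ((trivialGluing SoundInputChecks.toySettingTwo).linkMap o) : ℝ) : WithTop ℝ) ≤
          negLogThetaAt SoundInputChecks.toySettingTwo o := by
  intro o ho
  cases o with
  | false => exact absurd SoundInputChecks.toySettingTwo_negLogThetaAt_false ho
  | true =>
    show ((negLogQAt SoundInputChecks.toySettingTwo SoundInputChecks.toySettingTwo.qPilot : ℝ) : WithTop ℝ) ≤
      negLogThetaAt SoundInputChecks.toySettingTwo SoundInputChecks.toySettingTwo.thetaPilot
    rw [negLogQAt_qPilot, negLogThetaAt_thetaPilot]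
    exact SoundInputChecks.toySettingTwo_statement.2

end Summit.ABC.IUTFork.Cor312Vol

end
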